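import Summits.Ventures.LatticeQCDFlow.Scaling.TaggedHubCertificate

/-!
HONEST FRAMING: exact (Metropolis-corrected) sampling algorithms for lattice gauge theory; figures
of merit are autocorrelation/cost numbers at stated couplings and volumes; no continuum-physics
claim.

# TaggedHubLumping — THE TAGGED HUB CHAIN LUMPS TO THE CONTENT HUB CHAIN OF CHAPTER W FILE 4 (FORGETTING THE TAG), SO ITS TAIL RESOLVENT PUSHES FORWARD TO THE END-HUB TAIL
# LAW OF CHAPTER W FILE 7; ABSENT CONTENTS CARRY NO MASS (THE ★-CERTIFICATE WITHOUT THE «EVERY CONTENT PRESENT» PROVISO); AND FOR AN ADJACENT PAIR `N_X = N_C + δ_a`,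
# `N_Y = N_C + δ_b` THE GAIN OF CHAPTER V FILE 2 IS THE EXACT LINEAR-PLUS-PENALTY EXPRESSION `G = x̃(★) + x̃(a) − ỹ(a) − Σ_{c≠a,b}(ỹ(c) − x̃(c))⁺` (lean-2 GEN-37, ours)

Venture-side (OURS).  Cell `lqcd-flow` (pub-lqcd), unit `pub-lqcd-lean-2-g37`, 2026-08-29.  Chapter W (item 1 (i) at finite swap odds), file 15.  The tagged hub chain `P` on `Option S`
of file 14 (ordinary composition `N_C`, `Σ N_C = K`, tagged particle of content `s`) and the content hub chain `K_N` of chapter W file 4 for the full composition `N = N_C + δ_s`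
satisfy Dynkin's lumping identity for the map `cont : Option S → S` (`cont ★ = s`, `cont v = v`) on every row that can carry mass (★ and the present ordinary contents):
`Σ_{cont t' = w} P(t,t') = K_N(cont t, w)` (`lump_row`).  Consequently (support of the resolvent on present contents, chapter W file 1, + uniqueness of the content resolvent)
THE END-HUB TAIL LAW IS THE PUSH-FORWARD OF THE TAGGED TAIL LAW: `ũ(w) = x̃(w) + 𝟙{w = s}·x̃(★)` (`lump_tail`).  §1 also removes the proviso `N_C(v) ≠ 0 ∀v` from file 14's
certificate (absent contents are never visited: `tagged_tail_absent`; the reward there is immaterial: `tagged_certificate_tail'`).  §3: for two copies `N_X = N_C + δ_a`,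
`N_Y = N_C + δ_b` (`a ≠ b`; `A = {a}`, `B = {b}`, `C` = the rest) with tagged tail laws `x̃`, `ỹ` and their push-forwards `ũ_X`, `ũ_Y`, the gain
`G(ũ_X,ũ_Y) = ũ_X(A) − ũ_Y(A) − Σ_C(ũ_Y − ũ_X)⁺` of chapter V file 2 equals `x̃(★) + (x̃(a) − ỹ(a)) − Σ_{c∉{a,b}}(ỹ(c) − x̃(c))⁺` (`adjacent_gain_eq`), hence under DOMINATION
of the ordinary occupations (`ỹ(c) ≤ x̃(c)` for `c ∉ {a,b}` and `ỹ(a) ≤ x̃(a)` — MEMO-gen37's Conjecture D, the copy `X` holding the MORE persistent extra particle)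
**`G(ũ_X,ũ_Y) = x̃(★) + x̃(a) − ỹ(a) ≥ x̃(★)`** (`adjacent_gain_ge_of_domination`): the optimal coupling disappears from the criterion.  Hypothesis-equations, no definitions.

## What is proved

* §1 `tagged_absent_col`, `tagged_tail_absent`, **`tagged_certificate_tail'`** (file 14's tail certificate with no presence proviso).
* §2 `comp_tag_apply`, `comp_tag_ne`, `lump_row_some`, `lump_row_none`, **`lump_row`**, **`lump_tail`** (`ũ = cont_* x̃`), `lump_cost` (`Σ_w ũ(w)(1−θ_w) = Σ_v x̃(v)(1−θ_v) + x̃(★)(1−θ_s)`).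
* §3 `adjacent_surplus_iff`, `adjacent_common_iff`, **`adjacent_gain_eq`**, **`adjacent_gain_ge_of_domination`**.

Reading (no numerics implied): plumbing between the tagged picture (where the ★-certificate and domination live) and the content picture (where the cycle chain of chapter V∕W lives).
NOT CLAIMED: domination.  Literature grade (cell rule): OWN, elementary; nothing cited as a fact; no new bib keys.
-/

open Finset

namespace Summit.Ventures.LatticeQCDFlow.Scaling

section LumpAbsent
variable {S : Type*} [Fintype S] [DecidableEq S]
variable {W θ : S → ℝ} {acc : S → S → ℝ} {p : ℝ} {K : ℕ} {NC : S → ℕ} {s : S} {P : Option S → Option S → ℝ}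

/-! ## §1 Absent contents carry no mass -/

omit [Fintype S] [DecidableEq S] in
/-- Into an absent ordinary content (`N_C(w) = 0`) every rate vanishes, from ★ and from every other row. [ours] -/
theorem tagged_absent_col (hPoff : ∀ h v, h ≠ v → P (some h) (some v) = if NC h = 0 then 0 else (NC v : ℝ) / K * acc h v)
    (hPout : ∀ v, P none (some v) = (NC v : ℝ) / K * acc s v) {w : S} (hw : NC w = 0) :
    P none (some w) = 0 ∧ ∀ h, h ≠ w → P (some h) (some w) = 0 := by
  refine ⟨by rw [hPout, hw]; simp, fun h hhw => ?_⟩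
  rw [hPoff h w hhw, hw]; simp

/-- **The tagged tail resolvent from a present ordinary hub gives no mass to absent contents.** [ours] -/
theorem tagged_tail_absent (hW : ∀ v, 0 < W v) (hacc : ∀ h v, acc h v = min 1 (W h / W v))
    (hPoff : ∀ h v, h ≠ v → P (some h) (some v) = if NC h = 0 then 0 else (NC v : ℝ) / K * acc h v)
    (hPin : ∀ h, P (some h) none = if NC h = 0 then 0 else acc h s / K)
    (hPdiag : ∀ h, P (some h) (some h) = 1 - (∑ v ∈ univ.erase h, P (some h) (some v) + P (some h) none))
    (hPout : ∀ v, P none (some v) = (NC v : ℝ) / K * acc s v) (hPstay : P none none = 1 - ∑ v, P none (some v))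
    (hK : 1 ≤ K) (hNC : ∑ v, NC v = K) {σ : ℝ} (hσ0 : 0 ≤ σ) (hσ1 : σ < 1) {z : S} (hz : NC z ≠ 0)
    {ut : Option S → ℝ} (hut : ∀ t, ut t = (1 - σ) * P (some z) t + σ * ∑ t', ut t' * P t' t) {w : S} (hw : NC w = 0) : ut (some w) = 0 := by
  classical
  have hP0 := tagged_nonneg hW hacc hPoff hPin hPdiag hPout hPstay hK hNC
  have hP1 := tagged_rowsum (P := P) hPdiag hPstay
  refine geomResolvent_support_subset hP0 hP1 hσ0 hσ1 (ν := fun t => P (some z) t) hut (fun t => t = none ∨ ∃ v, t = some v ∧ NC v ≠ 0)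
    (fun t ht => ?_) (fun t' t hG hnG => ?_) (some w)
    (by
      rintro (h | ⟨v, hv, hne⟩)
      · exact Option.some_ne_none w h
      · exact hne ((Option.some_inj.mp hv) ▸ hw))
  · -- `P(some z, t) = 0` off the good set: `t = some v` with `N_C(v) = 0`, `v ≠ z`
    rcases t with _ | v
    · exact absurd (Or.inl rfl) ht
    · have hv : NC v = 0 := by by_contra h; exact ht (Or.inr ⟨v, rfl, h⟩)
      have hzv : z ≠ v := fun e => hz (e ▸ hv)
      exact ((tagged_absent_col hPoff hPout hv).2 z hzv)
  · rcases t with _ | v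
    · exact absurd (Or.inl rfl) hnG
    · have hv : NC v = 0 := by by_contra h; exact hnG (Or.inr ⟨v, rfl, h⟩)
      rcases t' with _ | h
      · exact (tagged_absent_col hPoff hPout hv).1
      · have hh : NC h ≠ 0 := by
          rcases hG with h0 | ⟨v', hv', hne⟩
          · exact absurd h0 (Option.some_ne_none h)
          · exact (Option.some_inj.mp hv') ▸ hne
        exact (tagged_absent_col hPoff hPout hv).2 h (fun e => hh (e ▸ hv))

/-- **THE ★-CERTIFICATE, TAIL FORM, WITHOUT THE PRESENCE PROVISO** (absent contents are never visited, so file 14's theorem applies to the chain restricted in effect to the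
present ones; formally: the reward at absent contents is immaterial because `ũ` vanishes there). [ours] -/
theorem tagged_certificate_tail' (hW : ∀ v, 0 < W v) (hp0 : 0 ≤ p) (hp : ∀ v, p * W v ≤ 1) (hθ : ∀ v, θ v = 1 / (1 + p * W v))
    (hacc : ∀ h v, acc h v = min 1 (W h / W v))
    (hPoff : ∀ h v, h ≠ v → P (some h) (some v) = if NC h = 0 then 0 else (NC v : ℝ) / K * acc h v)
    (hPin : ∀ h, P (some h) none = if NC h = 0 then 0 else acc h s / K)
    (hPdiag : ∀ h, P (some h) (some h) = 1 - (∑ v ∈ univ.erase h, P (some h) (some v) + P (some h) none))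
    (hPout : ∀ v, P none (some v) = (NC v : ℝ) / K * acc s v) (hPstay : P none none = 1 - ∑ v, P none (some v))
    (hK : 1 ≤ K) (hNC : ∑ v, NC v = K) {M : ℝ} (hM : M = ∑ v, θ v * (NC v : ℝ) + θ s)
    {σ : ℝ} (hσ0 : 0 ≤ σ) (hσ1 : σ < 1) {z : S} (hz : NC z ≠ 0) {ut : Option S → ℝ} (hut : ∀ t, ut t = (1 - σ) * P (some z) t + σ * ∑ t', ut t' * P t' t) :
    (1 - σ) * (1 - θ s) * ut none ≤ (K + M) * ut none - (∑ v, ut (some v) * (1 - θ v) + ut none * (1 - θ s)) := by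
  classical
  -- the super-solution of file 14 with the reward relaxed to `0` at absent contents
  set r : Option S → ℝ := fun t => Option.elim t ((K + M) - (1 - θ s)) (fun v => if NC v = 0 then 0 else -(1 - θ v)) with hr
  set Λ : Option S → ℝ := fun t => Option.elim t (-(1 - θ s)) (fun _ => 0) with hΛ
  -- the genuine reward
  set r0 : Option S → ℝ := fun t => Option.elim t ((K + M) - (1 - θ s)) (fun v => -(1 - θ v)) with hr0
  have hP0 := tagged_nonneg hW hacc hPoff hPin hPdiag hPout hPstay hK hNC
  have hP1 := tagged_rowsum (P := P) hPdiag hPstay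
  -- on rows that carry mass the two rewards have the same one-step expectation
  have hrow : ∀ t, (t = none ∨ ∃ v, t = some v ∧ NC v ≠ 0) → ∑ t', P t t' * (r t' + Λ t') = ∑ t', P t t' * (r0 t' + Λ t') := by
    intro t ht
    refine sum_congr rfl fun t' _ => ?_
    rcases t' with _ | w
    · simp [hr, hr0]
    · by_cases hw : NC w = 0
      · have hcol := tagged_absent_col hPoff hPout hw
        have hzero : P t (some w) = 0 := by
          rcases ht with h0 | ⟨v, hv, hne⟩
          · rw [h0]; exact hcol.1
          · rw [hv]; exact hcol.2 v (fun e => hne (e ▸ hw))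
        rw [hzero]; ring
      · simp [hr, hr0, hw]
  have hsup0 : ∀ t, (t = none ∨ ∃ v, t = some v ∧ NC v ≠ 0) → Λ t ≤ ∑ t', P t t' * (r0 t' + Λ t') := by
    intro t ht
    rcases t with _ | v
    · exact tagged_supersolution_none hW hp0 hp hθ hacc hPout hPstay hK hNC hM (r := r0) (Λ := Λ) (by simp [hr0]) (fun v => by simp [hr0])
        (by simp [hΛ]) (fun v => by simp [hΛ])
    · have hv : NC v ≠ 0 := by
        rcases ht with h0 | ⟨v', hv', hne⟩
        · exact absurd h0 (Option.some_ne_none v)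
        · exact (Option.some_inj.mp hv') ▸ hne
      exact tagged_supersolution_some hW hp0 hp hθ hacc hPoff hPin hPdiag hK hNC hM (r := r0) (Λ := Λ) (by simp [hr0]) (fun v => by simp [hr0])
        (by simp [hΛ]) (fun v => by simp [hΛ]) hv
  have hsup : ∀ t, Λ t ≤ ∑ t', P t t' * (r t' + Λ t') := by
    intro t
    by_cases ht : t = none ∨ ∃ v, t = some v ∧ NC v ≠ 0
    · rw [hrow t ht]; exact hsup0 t ht
    · -- absent ordinary row: the identity, reward `0`
      rcases t with _ | v
      · exact absurd (Or.inl rfl) ht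
      · have hv : NC v = 0 := by by_contra h; exact ht (Or.inr ⟨v, rfl, h⟩)
        have hdiag : P (some v) (some v) = 1 := by
          rw [hPdiag, sum_eq_zero fun w hw => by rw [hPoff v w (ne_of_mem_erase hw).symm, if_pos hv], hPin, if_pos hv]; norm_num
        have hoff : ∀ t', t' ≠ some v → P (some v) t' = 0 := by
          intro t' ht'
          have h1 := hP1 (some v)
          rw [← Finset.sum_erase_add univ _ (mem_univ (some v)), hdiag] at h1
          have hs : ∑ x ∈ univ.erase (some v), P (some v) x = 0 := by linarith
          exact (sum_eq_zero_iff_of_nonneg fun t _ => hP0 (some v) t).mp hs t' (mem_erase.mpr ⟨ht', mem_univ _⟩)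
        rw [← Finset.sum_erase_add univ _ (mem_univ (some v)), sum_eq_zero fun t' ht' => by rw [hoff t' (ne_of_mem_erase ht'), zero_mul], hdiag]
        simp [hΛ, hr, hv]
  have hut0 : ∀ t, 0 ≤ ut t := geomResolvent_nonneg hP0 hP1 hσ0 hσ1 (ν := fun t => P (some z) t) (fun t => hP0 _ _) hut
  have h := tail_expect_ge_of_supersolution hσ0 hσ1.le hsup hut0 hut
  have hΛz : Λ (some z) = 0 := by simp [hΛ]
  have hEΛ : ∑ t, ut t * Λ t = -(1 - θ s) * ut none := by rw [tagged_sum_option]; simp [hΛ]; ring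
  -- the relaxed reward has the same expectation as the genuine one under `ũ`
  have habs : ∀ w, NC w = 0 → ut (some w) = 0 := fun w hw => tagged_tail_absent hW hacc hPoff hPin hPdiag hPout hPstay hK hNC hσ0 hσ1 hz hut hw
  have hEr : ∑ t, ut t * r t = (K + M) * ut none - (∑ v, ut (some v) * (1 - θ v) + ut none * (1 - θ s)) := by
    rw [tagged_sum_option]; simp only [hr, Option.elim_none, Option.elim_some]
    have e : ∑ v, ut (some v) * (if NC v = 0 then (0 : ℝ) else -(1 - θ v)) = -∑ v, ut (some v) * (1 - θ v) := by
      rw [← sum_neg_distrib]; refine sum_congr rfl fun v _ => ?_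
      by_cases hv : NC v = 0
      · rw [if_pos hv, habs v hv]; ring
      · rw [if_neg hv]; ring
    rw [e]; ring
  rw [hΛz, hEΛ, hEr] at h
  linarith

end LumpAbsent

/-! ## §2 Lumping to the content chain -/

section Lump
variable {S : Type*} [Fintype S] [DecidableEq S]
variable {W θ : S → ℝ} {acc : S → S → ℝ} {p : ℝ} {K : ℕ} {NC N : S → ℕ} {s : S} {P : Option S → Option S → ℝ} {Kh : S → S → ℝ}

omit [Fintype S] in
/-- The full composition `N = N_C + δ_s` at `s`. [ours] -/
theorem comp_tag_apply (hN : N = NC + Pi.single s 1) : N s = NC s + 1 := by rw [hN]; simp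

omit [Fintype S] in
/-- The full composition off `s`. [ours] -/
theorem comp_tag_ne (hN : N = NC + Pi.single s 1) {v : S} (hv : v ≠ s) : N v = NC v := by rw [hN]; simp [hv]

/-- **Lumping, ordinary rows:** for a present ordinary hub `h` and every content `w`, `P(h, w) + 𝟙{w = s}P(h, ★) = K_N(h, w)`. [ours] -/
theorem lump_row_some (hN : N = NC + Pi.single s 1)
    (hPoff : ∀ h v, h ≠ v → P (some h) (some v) = if NC h = 0 then 0 else (NC v : ℝ) / K * acc h v)
    (hPin : ∀ h, P (some h) none = if NC h = 0 then 0 else acc h s / K)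
    (hPdiag : ∀ h, P (some h) (some h) = 1 - (∑ v ∈ univ.erase h, P (some h) (some v) + P (some h) none))
    (hKoff : ∀ h v, h ≠ v → Kh h v = if N h = 0 then 0 else (N v : ℝ) / K * acc h v) (hKdiag : ∀ h, Kh h h = 1 - ∑ v ∈ univ.erase h, Kh h v)
    {h : S} (hh : NC h ≠ 0) (w : S) : P (some h) (some w) + (if w = s then P (some h) none else 0) = Kh h w := by
  have hNh : N h ≠ 0 := by
    by_cases hhs : h = s
    · subst hhs; rw [comp_tag_apply hN]; exact Nat.succ_ne_zero _
    · rw [comp_tag_ne hN hhs]; exact hh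
  -- off-diagonal contents first
  have hoff : ∀ w, w ≠ h → P (some h) (some w) + (if w = s then P (some h) none else 0) = Kh h w := by
    intro w hwh
    rw [hPoff h w hwh.symm, if_neg hh, hKoff h w hwh.symm, if_neg hNh, hPin, if_neg hh]
    by_cases hws : w = s
    · subst hws; rw [if_pos rfl, comp_tag_apply hN]; push_cast; ring
    · rw [if_neg hws, comp_tag_ne hN hws, add_zero]
  by_cases hwh : w = h
  · subst hwh
    -- the diagonal: both rows sum to one
    rw [hPdiag, hKdiag]
    have e : ∑ v ∈ univ.erase w, Kh w v = ∑ v ∈ univ.erase w, (P (some w) (some v) + (if v = s then P (some w) none else 0)) :=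
      sum_congr rfl fun v hv => (hoff v (ne_of_mem_erase hv)).symm
    rw [e, sum_add_distrib]
    by_cases hws : w = s
    · subst hws
      have : ∑ v ∈ univ.erase w, (if v = w then P (some w) none else 0) = 0 := sum_eq_zero fun v hv => by rw [if_neg (ne_of_mem_erase hv)]
      rw [this, if_pos rfl]; ring
    · rw [Finset.sum_ite_eq' (univ.erase w) s (fun _ => P (some w) none), if_pos (mem_erase.mpr ⟨Ne.symm hws, mem_univ _⟩), if_neg hws]; ring
  · exact hoff w hwh

/-- **Lumping, the ★ row:** `P(★, w) + 𝟙{w = s}P(★, ★) = K_N(s, w)`. [ours] -/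
theorem lump_row_none (hN : N = NC + Pi.single s 1)
    (hPout : ∀ v, P none (some v) = (NC v : ℝ) / K * acc s v) (hPstay : P none none = 1 - ∑ v, P none (some v))
    (hKoff : ∀ h v, h ≠ v → Kh h v = if N h = 0 then 0 else (N v : ℝ) / K * acc h v) (hKdiag : ∀ h, Kh h h = 1 - ∑ v ∈ univ.erase h, Kh h v)
    (w : S) : P none (some w) + (if w = s then P none none else 0) = Kh s w := by
  have hNs : N s ≠ 0 := by rw [comp_tag_apply hN]; exact Nat.succ_ne_zero _
  have hoff : ∀ w, w ≠ s → P none (some w) = Kh s w := by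
    intro w hws; rw [hPout, hKoff s w (Ne.symm hws), if_neg hNs, comp_tag_ne hN hws]
  by_cases hws : w = s
  · subst hws
    rw [if_pos rfl, hPstay, hKdiag, ← Finset.sum_erase_add univ (fun v => P none (some v)) (mem_univ w)]
    have e : ∑ v ∈ univ.erase w, Kh w v = ∑ v ∈ univ.erase w, P none (some v) := sum_congr rfl fun v hv => (hoff v (ne_of_mem_erase hv)).symm
    rw [e]; ring
  · rw [if_neg hws, add_zero]; exact hoff w hws

/-- **DYNKIN'S LUMPING IDENTITY** on every row that can carry mass (`t = ★` or a present ordinary content): `Σ_{t'} P(t,t')·𝟙{cont t' = w} = K_N(cont t, w)`, written as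
`P(t, w) + 𝟙{w = s}P(t, ★)`. [ours] -/
theorem lump_row (hN : N = NC + Pi.single s 1)
    (hPoff : ∀ h v, h ≠ v → P (some h) (some v) = if NC h = 0 then 0 else (NC v : ℝ) / K * acc h v)
    (hPin : ∀ h, P (some h) none = if NC h = 0 then 0 else acc h s / K)
    (hPdiag : ∀ h, P (some h) (some h) = 1 - (∑ v ∈ univ.erase h, P (some h) (some v) + P (some h) none))
    (hPout : ∀ v, P none (some v) = (NC v : ℝ) / K * acc s v) (hPstay : P none none = 1 - ∑ v, P none (some v))
    (hKoff : ∀ h v, h ≠ v → Kh h v = if N h = 0 then 0 else (N v : ℝ) / K * acc h v) (hKdiag : ∀ h, Kh h h = 1 - ∑ v ∈ univ.erase h, Kh h v)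
    (t : Option S) (ht : t = none ∨ ∃ v, t = some v ∧ NC v ≠ 0) (w : S) :
    P t (some w) + (if w = s then P t none else 0) = Kh (Option.elim t s id) w := by
  rcases t with _ | h
  · exact lump_row_none hN hPout hPstay hKoff hKdiag w
  · have hh : NC h ≠ 0 := by
      rcases ht with h0 | ⟨v, hv, hne⟩
      · exact absurd h0 (Option.some_ne_none h)
      · exact (Option.some_inj.mp hv) ▸ hne
    exact lump_row_some hN hPoff hPin hPdiag hKoff hKdiag hh w

/-- **THE END-HUB TAIL LAW IS THE PUSH-FORWARD OF THE TAGGED TAIL LAW:** if `x̃ = (1−σ)P(z,·) + σx̃P` on `Option S` and `ũ = (1−σ)K_N(z,·) + σũK_N` on `S` (present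
ordinary start `z`, `0 ≤ σ < 1`), then `ũ(w) = x̃(w) + 𝟙{w = s}·x̃(★)` for every content `w`. [ours] -/
theorem lump_tail (hW : ∀ v, 0 < W v) (hacc : ∀ h v, acc h v = min 1 (W h / W v)) (hN : N = NC + Pi.single s 1)
    (hPoff : ∀ h v, h ≠ v → P (some h) (some v) = if NC h = 0 then 0 else (NC v : ℝ) / K * acc h v)
    (hPin : ∀ h, P (some h) none = if NC h = 0 then 0 else acc h s / K)
    (hPdiag : ∀ h, P (some h) (some h) = 1 - (∑ v ∈ univ.erase h, P (some h) (some v) + P (some h) none))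
    (hPout : ∀ v, P none (some v) = (NC v : ℝ) / K * acc s v) (hPstay : P none none = 1 - ∑ v, P none (some v))
    (hKoff : ∀ h v, h ≠ v → Kh h v = if N h = 0 then 0 else (N v : ℝ) / K * acc h v) (hKdiag : ∀ h, Kh h h = 1 - ∑ v ∈ univ.erase h, Kh h v)
    (hK : 1 ≤ K) (hNC : ∑ v, NC v = K) {σ : ℝ} (hσ0 : 0 ≤ σ) (hσ1 : σ < 1) {z : S} (hz : NC z ≠ 0)
    {xt : Option S → ℝ} (hxt : ∀ t, xt t = (1 - σ) * P (some z) t + σ * ∑ t', xt t' * P t' t)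
    {ut : S → ℝ} (hut : ∀ w, ut w = (1 - σ) * Kh z w + σ * ∑ h, ut h * Kh h w) :
    ∀ w, ut w = xt (some w) + (if w = s then xt none else 0) := by
  classical
  -- the content chain is stochastic (chapter W file 4, with `Σ N = K + 1`)
  have hsumN : ∑ v, N v = K + 1 := by
    rw [hN]; simp only [Pi.add_apply]; rw [sum_add_distrib, hNC, Finset.sum_pi_single']; simp
  have hK0 : ∀ a b, 0 ≤ Kh a b := starHub_nonneg hW hacc hKoff hKdiag hK hsumN
  have hK1 : ∀ a, ∑ b, Kh a b = 1 := starHub_rowsum hKdiag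
  -- the push-forward solves the content resolvent equation
  set uh : S → ℝ := fun w => xt (some w) + (if w = s then xt none else 0) with huh
  have habs : ∀ w, NC w = 0 → xt (some w) = 0 := fun w hw => tagged_tail_absent hW hacc hPoff hPin hPdiag hPout hPstay hK hNC hσ0 hσ1 hz hxt hw
  have hgood : ∀ t, xt t ≠ 0 → (t = none ∨ ∃ v, t = some v ∧ NC v ≠ 0) := by
    intro t ht; rcases t with _ | v
    · exact Or.inl rfl
    · exact Or.inr ⟨v, rfl, fun hv => ht (habs v hv)⟩
  have hreg : ∀ w, ∑ h, uh h * Kh h w = ∑ t, xt t * Kh (Option.elim t s id) w := by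
    intro w
    rw [tagged_sum_option]
    simp only [Option.elim_none, Option.elim_some, id, huh]
    have e : ∀ h, (xt (some h) + (if h = s then xt none else 0)) * Kh h w = xt (some h) * Kh h w + (if h = s then xt none * Kh s w else 0) := by
      intro h; by_cases hh : h = s
      · rw [if_pos hh, if_pos hh, hh]; ring
      · rw [if_neg hh, if_neg hh]; ring
    rw [sum_congr rfl fun h _ => e h, sum_add_distrib, Finset.sum_ite_eq' univ s]; simp only [mem_univ, if_true]; ring
  have hl2 : ∀ w, ∑ t, xt t * Kh (Option.elim t s id) w = ∑ t, xt t * P t (some w) + (if w = s then ∑ t, xt t * P t none else 0) := by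
    intro w
    have hlump : ∀ t, xt t * Kh (Option.elim t s id) w = xt t * P t (some w) + (if w = s then xt t * P t none else 0) := by
      intro t
      by_cases ht : xt t = 0
      · rw [ht]; simp
      · rw [← lump_row hN hPoff hPin hPdiag hPout hPstay hKoff hKdiag t (hgood t ht) w]
        by_cases hws : w = s
        · rw [if_pos hws, if_pos hws]; ring
        · rw [if_neg hws, if_neg hws]; ring
    rw [sum_congr rfl fun t _ => hlump t, sum_add_distrib]
    by_cases hws : w = s
    · simp only [if_pos hws]
    · simp only [if_neg hws, sum_const_zero]
  have heq : ∀ w, uh w = (1 - σ) * Kh z w + σ * ∑ h, uh h * Kh h w := by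
    intro w
    have hz' := lump_row_some hN hPoff hPin hPdiag hKoff hKdiag hz w
    rw [hreg w, hl2 w, ← hz']
    simp only [huh]
    rw [hxt (some w)]
    by_cases hws : w = s
    · rw [if_pos hws, if_pos hws, if_pos hws, hxt none]; ring
    · rw [if_neg hws, if_neg hws, if_neg hws]; ring
  -- uniqueness of the content resolvent
  have huniq := geomResolvent_unique hK0 hK1 hσ0 hσ1 (ν := fun w => Kh z w) hut heq
  intro w
  have := congrFun huniq w
  rw [this]

/-- The cost functional pushes forward: `Σ_w ũ(w)(1−θ_w) = Σ_v x̃(v)(1−θ_v) + x̃(★)(1−θ_s)`. [ours] -/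
theorem lump_cost {xt : Option S → ℝ} {ut : S → ℝ} (hlump : ∀ w, ut w = xt (some w) + (if w = s then xt none else 0)) :
    ∑ w, ut w * (1 - θ w) = ∑ v, xt (some v) * (1 - θ v) + xt none * (1 - θ s) := by
  classical
  calc ∑ w, ut w * (1 - θ w) = ∑ w, (xt (some w) * (1 - θ w) + (if w = s then xt none else 0) * (1 - θ w)) :=
        sum_congr rfl fun w _ => by rw [hlump w]; ring
    _ = ∑ v, xt (some v) * (1 - θ v) + xt none * (1 - θ s) := by
        rw [sum_add_distrib]; congr 1; simp_rw [ite_mul, zero_mul]; rw [Finset.sum_ite_eq' univ s]; simp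

end Lump

/-! ## §3 The gain of an adjacent pair in the tagged picture -/

section Adjacent
variable {S : Type*} [Fintype S] [DecidableEq S]
variable {NC NX NY : S → ℕ} {a b : S} {xt yt : Option S → ℝ} {utX utY : S → ℝ}

omit [Fintype S] in
/-- `N_Y(w) < N_X(w)` iff `w = a` (`N_X = N_C + δ_a`, `N_Y = N_C + δ_b`, `a ≠ b`). [ours] -/
theorem adjacent_surplus_iff (hX : NX = NC + Pi.single a 1) (hY : NY = NC + Pi.single b 1) (hab : a ≠ b) (w : S) : NY w < NX w ↔ w = a := by
  rw [hX, hY]; simp only [Pi.add_apply, Pi.single_apply]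
  by_cases hwa : w = a
  · subst hwa; simp [hab]
  · by_cases hwb : w = b
    · subst hwb; simp [hwa]
    · simp [hwa, hwb]

omit [Fintype S] in
/-- `N_X(w) = N_Y(w)` iff `w ∉ {a, b}`. [ours] -/
theorem adjacent_common_iff (hX : NX = NC + Pi.single a 1) (hY : NY = NC + Pi.single b 1) (hab : a ≠ b) (w : S) : NX w = NY w ↔ (w ≠ a ∧ w ≠ b) := by
  rw [hX, hY]; simp only [Pi.add_apply, Pi.single_apply]
  by_cases hwa : w = a
  · subst hwa; simp [hab]
  · by_cases hwb : w = b
    · subst hwb; simp [hwa]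
    · simp [hwa, hwb]

/-- **THE GAIN OF AN ADJACENT PAIR IS LINEAR PLUS A PENALTY ON COMMON CONTENTS:** with `ũ_X = cont_* x̃` (tag content `a`) and `ũ_Y = cont_* ỹ` (tag content `b`),
`G(ũ_X,ũ_Y) = x̃(★) + (x̃(a) − ỹ(a)) − Σ_{w∉{a,b}} (ỹ(w) − x̃(w))⁺`. [ours] -/
theorem adjacent_gain_eq (hX : NX = NC + Pi.single a 1) (hY : NY = NC + Pi.single b 1) (hab : a ≠ b)
    (hlX : ∀ w, utX w = xt (some w) + (if w = a then xt none else 0)) (hlY : ∀ w, utY w = yt (some w) + (if w = b then yt none else 0)) :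
    ∑ w, utX w * (if NY w < NX w then (1 : ℝ) else 0) - ∑ w, utY w * (if NY w < NX w then (1 : ℝ) else 0)
        - ∑ w, max (utY w - utX w) 0 * (if NX w = NY w then (1 : ℝ) else 0)
      = xt none + (xt (some a) - yt (some a)) - ∑ w, (if w ≠ a ∧ w ≠ b then max (yt (some w) - xt (some w)) 0 else 0) := by
  classical
  have hs : ∀ w, (if NY w < NX w then (1 : ℝ) else 0) = if w = a then 1 else 0 := fun w => by
    by_cases h : w = a
    · rw [if_pos ((adjacent_surplus_iff hX hY hab w).mpr h), if_pos h]
    · rw [if_neg (fun h' => h ((adjacent_surplus_iff hX hY hab w).mp h')), if_neg h]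
  have hc : ∀ w, (if NX w = NY w then (1 : ℝ) else 0) = if (w ≠ a ∧ w ≠ b) then 1 else 0 := fun w => by
    by_cases h : (w ≠ a ∧ w ≠ b)
    · rw [if_pos ((adjacent_common_iff hX hY hab w).mpr h), if_pos h]
    · rw [if_neg (fun h' => h ((adjacent_common_iff hX hY hab w).mp h')), if_neg h]
  simp_rw [hs, hc, mul_ite, mul_one, mul_zero]
  rw [Finset.sum_ite_eq' univ a, Finset.sum_ite_eq' univ a]
  simp only [mem_univ, if_true]
  rw [hlX a, hlY a, if_pos rfl, if_neg hab]
  have e : ∀ w, (if (w ≠ a ∧ w ≠ b) then max (utY w - utX w) 0 else 0) = if (w ≠ a ∧ w ≠ b) then max (yt (some w) - xt (some w)) 0 else 0 := by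
    intro w
    by_cases h : (w ≠ a ∧ w ≠ b)
    · rw [if_pos h, if_pos h, hlX w, hlY w, if_neg h.1, if_neg h.2]; ring_nf
    · rw [if_neg h, if_neg h]
  rw [sum_congr rfl fun w _ => e w]; ring

/-- **UNDER DOMINATION THE GAIN IS LINEAR:** if `ỹ(w) ≤ x̃(w)` for every `w ∉ {a,b}` and `ỹ(a) ≤ x̃(a)`, then `G(ũ_X,ũ_Y) = x̃(★) + x̃(a) − ỹ(a) ≥ x̃(★)`. [ours] -/
theorem adjacent_gain_ge_of_domination (hX : NX = NC + Pi.single a 1) (hY : NY = NC + Pi.single b 1) (hab : a ≠ b)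
    (hlX : ∀ w, utX w = xt (some w) + (if w = a then xt none else 0)) (hlY : ∀ w, utY w = yt (some w) + (if w = b then yt none else 0))
    (hdomC : ∀ w, w ≠ a → w ≠ b → yt (some w) ≤ xt (some w)) (hdoma : yt (some a) ≤ xt (some a)) :
    xt none ≤ ∑ w, utX w * (if NY w < NX w then (1 : ℝ) else 0) - ∑ w, utY w * (if NY w < NX w then (1 : ℝ) else 0)
        - ∑ w, max (utY w - utX w) 0 * (if NX w = NY w then (1 : ℝ) else 0) := by
  classical
  rw [adjacent_gain_eq hX hY hab hlX hlY]
  have hpen : ∑ w, (if w ≠ a ∧ w ≠ b then max (yt (some w) - xt (some w)) 0 else (0 : ℝ)) = 0 := by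
    refine sum_eq_zero fun w _ => ?_
    by_cases h : (w ≠ a ∧ w ≠ b)
    · rw [if_pos h, max_eq_right (by linarith [hdomC w h.1 h.2])]
    · rw [if_neg h]
  rw [hpen]; linarith

end Adjacent

end Summit.Ventures.LatticeQCDFlow.Scaling
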